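import Mathlib
import HarnessLib
import HarnessLib.Audit
import Summits.HodgeConjecture.HodgeConjecture.Statement
import Literature.AlgebraicGeometry.HodgeTheory.GysinFormalism
import Literature.Barriers.HodgeConjecture.ExceptionalHodgeClasses

/-!
Route: WeilConeBoundary

CLOSED (retired) 2026-08-15T13:48:18Z by operator:999:1257524 — reason: not-a-thesis: assembly does not conclude the sub-problem Statement — note: D-0027 §2.1 audit (human 2026-08-15: routes that do not decide the summit are removed): the assembly concludes `Target`, not the sub-problem statement; a NEW conforming route may be opened from the same idea (generated `closes : … → _root_.HodgeConjecture`).. The file is kept as the record of this route; refuted decls are indexed as negative knowledge (`ledger negatives`).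

X (it suffices to show, for the WEIL SECTOR this route serves): on every polarized abelian 2n-fold
of Weil type (A, K = Q(sqrt -d), h), n >= 2, which is Hodge-generic in degree 2n (B^n(A) (x) C =
C.h^n (+) W, W = the two K-eigenlines wedge^{2n}V_sigma (+) wedge^{2n}V_sigmabar, rho = 1) and whose
van Geemen hermitian form H on H_1(A,Q) is HYPERBOLIC (equivalently (-1)^n det H in Nm(K^*), i.e. a
= 1 in vanGeemen1994HodgeAV (5.4.1); equivalently H^1(A,Q) contains a K-stable subspace of dimension
2n that is Lagrangian for (x,y) -> x.y.h^{2n-1}), the Weil classes are algebraic: every rational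
(n,n) class of W lies in algebraicClasses A.X n.
Lean (Sketch.lean rc 0, real carriers: AbelianVariety C, complexBetti, cupProduct, IsRationalClass,
IsOfHodgeType, divisorClassesSpan/divisorMonomials, restrictCompl, algebraicClasses): decl `Target`
of the route file = forall (n A K sigma iota e W), [Hodge-generic polarized Weil datum] -> [exists
K-stable rational Lagrangian 2n-frame u in H^1 w.r.t. u_i.u_j.f = 0, f a nonzero divisor monomial of
degree 2n-1] -> forall w in W, IsRationalClass w -> IsOfHodgeType (2n) A.X (2n) n n w -> w in
algebraicClasses A.X n.
MECHANISM (card weil-discriminant-exposed-ray, corrected to the STRONG cone per its two novelty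
audits): the translation-averaged classes of irreducible n-dimensional subvarieties V of A lie in
the 3-dimensional round cone C_s = Strong^n cap (R h^n (+) W_R) (DebarreEtAl2011 Lemma 1.5); its
exit parameter is s0 = 2 for every n (dual certificate (omega_z^n + omega_u^n)/(2 n!) - Re(e^{-i
theta} w_sigma), AM-GM), so in cohomology [V] = a e + w satisfies (-1)^n C(2n,n)(w.w)(e.e) <=
2([V].e)^2 (SliceInequality), with EQUALITY iff every tangent plane of V is a unimodular graph, i.e.
V is an integral variety of Omega_sigma - lambda Omega_sigmabar with |lambda| = 1. Because s0 is
rational, the boundary of C_s meets rational classes off the axis iff the binary form (-1)^n(w.w) on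
W_Q represents 2(h^{2n})/C(2n,n) times a square, iff (-1)^n det H in Nm(K^*), iff H is hyperbolic
(DiscriminantDoor). The route bets that where the door is rational, nature puts a subvariety in it
(BoundaryEffective); one such V gives W subset Q[V] + Q h^n + K-translates, hence W algebraic
(WeilAlgebraicOfBoundary). Assembly: BoundaryEffective -> WeilAlgebraicOfBoundary ->
DiscriminantDoor -> Target. PARTIAL ROUTE: the assembly ends at the Weil-sector Target, not at
_root_.HodgeConjecture (see rationale).

Rationale: WHY THIS LINE (imports: convex duality of positive cones of (n,n)-forms [Demailly1982,
HarveyLawson1982, DebarreEtAl2011] x the arithmetic of Weil type [vanGeemen1994HodgeAV 5.2-5.4,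
Markman2025SecantWeil 1.1]). Every algebraicity proof for Weil classes produced cycles only under a
discriminant hypothesis and nobody says why: Schoen1988HodgeWeil (fourfolds and Q(sqrt-3) sixfolds,
'det H = 1'), Koike (Q(i) sixfolds, disc -1), Markman generalized Kummers (fourfolds, disc 1) and
Markman2025SecantWeil (sixfolds, all K, disc -1). Since sign det H = (-1)^n for signature (n,n) (vG
5.4: det H = (-1)^n a, a > 0), ALL of these are the class a = 1, i.e. H HYPERBOLIC. Planner's
computation this session (NOTES.md): the strong-cone slice over Q h^n (+) W is round with exit s0 =
2 (weak cone: 2^n; the card's t0 conflated the two, as audit r7/r14 found), hence rational; so 'the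
boundary ray in a rational direction is a rational class' is decided by one class in Q^*/Nm(K^*),
and the Pfaffian bookkeeping (W, Wbar E-isotropic, Pf[[0,M],[-M^t,0]] = (-1)^n det M, E = Tr(xi H))
gives exactly: rational door <=> (-1)^n det H in Nm <=> a = 1 <=> H hyperbolic. The door is
therefore rational precisely on the components where cycles have been FOUND, and the dual face says
what a boundary cycle must look like: an n-fold all of whose tangent planes are unimodular graphs z
-> u (integral varieties of Omega_sigma - lambda Omega_sigmabar, |lambda| = 1; for n = 2 complex
Lagrangian surfaces for a constant holomorphic symplectic form; n = 1 sanity: the diagonal of E x E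
sits exactly on the door). This converts 'find a cycle with an exotic class' into 'find an integral
variety of an explicit first-order holomorphic system whose class is forced', and explains the
discriminant pattern of 1988-2025 as convex geometry.
RANKED CRUXES. #2 BoundaryEffective (hyperbolic + Hodge-generic => some irreducible codim-n Z whose
class line is an off-axis boundary point: the existence bet; typed). #3 DiscriminantDoor (rational
door <=> K-stable rational Lagrangian 2n-subspace of H^1 for x.y.h^{2n-1}: the norm identity with
all constants, typed; cheap to refute by one explicit family, e.g. Markman's X x X^ sixfolds or
E^{2n}-models). #4 BoundaryEffectiveFourfold (n = 2 instance: calibration against Schoen/van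
Geemen/Markman fourfold cycles and the Lagrangian Schoen surfaces of Bae-Kool-Park arXiv:2208.09474
Ex. 4.32; cheapest test of the whole line where HC is a theorem). SUPPORT: SliceInequality (Psef in
Strong, DELV Lemma 1.5 + s0 = 2; infrastructure-heavy: currents/averaging), WeilAlgebraicOfBoundary
(K-translates of one boundary class span W; uses pull-back preserves algebraic classes =
QbarEnvelope.PullbackAlgebraic, and h^n algebraic), Target, Assembly (pure logic over identical
binders).
KILL CRITERIA. (i) DiscriminantDoor refuted with the door landing on NON-hyperbolic components =>
the 'explains 1988-2025' claim dies; restate with the corrected constant only if the corrected door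
still matches a = 1, else close. (ii) BoundaryEffectiveFourfold refuted (a hyperbolic Hodge-generic
Weil fourfold with no unimodular-Lagrangian surface, e.g. by showing sup over surfaces of the slice
ratio is < 1, or that the door ray is a limit of effective classes only) => close the route as
'doors are not effective' (Kollar-type phenomenon for real coefficients' boundary), census to card
volume-form-lagrangians-weil-classes. (iii) A proof that Markman's kappa(E) classes on disc -1
sixfolds are differences of interior effective classes with no boundary component is strong evidence
against #2 at n = 3.
SCOPE / HONESTY. PARTIAL ROUTE: Assembly ends at Target (Weil classes on hyperbolic Hodge-generic
Weil-type abelian varieties, all n), NOT at _root_.HodgeConjecture; the summit would further need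
the non-hyperbolic components (where this route predicts NO boundary cycle and says nothing
constructive), the passage generic -> all members (closedness of algebraicity along the Weil family:
foreseen glue, not filed), and Andre/Deligne-type reductions from abelian varieties to Weil classes
plus everything non-abelian. Value if #2-#4 land: a uniform mechanism for Weil classes on hyperbolic
components in EVERY dimension (open for 2n >= 8; new proof for n = 3), and a precise no-go (no
unimodular-Lagrangian n-folds off hyperbolic components).
NOT DECOMPOSED YET (tenure): split of BoundaryEffective into (a) local EDS/deformation theory of
unimodular-Lagrangian n-folds (N_V = Omega^{n-1}_V; shared with card
volume-form-lagrangians-weil-classes V1/V2 but with |lambda| = 1 and the class pinned to the door),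
(b) anchors in split hyperbolic models E^n x E^n (graphs of unimodular O_K-matrices are flat
boundary n-folds; DELV Thm 1: Psef = Strong there), (c) propagation along the U(n,n) family; the
weak/strong exit lemmas (|det Z||det U| <= 2^-n; s0 = 2 by moment-matching measures on {prod p_i =
prod (1-p_i)}) as prover lemmas under SliceInequality; the sixfold instance as a child once #4 is
decided.

Novelty: Nearest prior art (searched this session: zbMATH 'abelian varieties Weil type Hodge classes
discriminant' -> Markman2025SecantWeil, vanGeemen2022WeilDecomposable; zbMATH 'pseudoeffective cone
abelian varieties strongly positive' -> DebarreEtAl2011 (READ Lemma 1.5, Thms 1-2: Psef^k in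
Strong^k; Psef = Strong on E^n_CM and on A x A); galaxy 'abelian varieties of Weil type' --star all
-> LNM 1594 = vanGeemen1994HodgeAV (READ pp. 219-234: 4.14-4.16, Lemma 5.2, 5.4 normal form det H =
(-1)^n a, 7.1-7.4 Schoen's Pryms); Markman2025SecantWeil sec. 1.1 READ (status: fourfolds all;
sixfolds Q(sqrt-3) 'trivial', Q(i) and all K disc -1); card refs Demailly1982 (HC <=> approximation
of positive currents in a fixed class), BabaeeHuh2017 (current-level version false),
HarveyLawson1982 (faces of mass ball = calibrations); idea card volume-form-lagrangians-weil-classes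
(Omega_lambda-Lagrangians, any lambda, deformation engine; graded variant). Delta: nobody slices the
strong positive cone by Q h^n (+) W; the facts 'exit parameter s0 = 2 is rational for all n',
'rational door <=> H hyperbolic <=> a = 1', and the observation that every proved Weil case
1988-2025 sits on hyperbolic components are, as far as searched, new; the constructive target is
sharpened from 'some Omega_lambda-Lagrangian' to '|lambda| = 1 with class ON the door', with a typed
no-go off hyperbolic components. Grade expected: new-combination (positivity cones x Weil
arithmetic), per the card's two audits.  [refs: DebarreEtAl2011, Demailly1982, BabaeeHuh2017, HarveyLawson1982]

Barriers (technique_class: convex-cones,complex-analytic,weil-classes,abelian-varieties): - Literature.Barriers.HodgeConjecture.Weil1977_exceptionalHodgeClasses: met head-on, not evaded: the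
route lives on B^n != D^n (hypothesis divisorClassesSpan = C.e, conclusion about W); boundary cycles
are by construction outside the divisor ring (w != 0).
- Literature.Barriers.HodgeConjecture.Mumford1968_simpleFourfold_exceptionalHodgeClasses: idem at n
= 2 (BoundaryEffectiveFourfold is stated for Hodge-generic, hence simple, Weil fourfolds).
- Literature.Barriers.HodgeConjecture.Zucker1977_kaehlerTorus_noAnalyticCycles: the cone C_s, the
exit s0 = 2, the door criterion and the null-plane system exist verbatim on non-algebraic tori,
where no subvariety exists; hence SliceInequality/DiscriminantDoor prove nothing alone and
BoundaryEffective MUST use projectivity (rho = 1 with an ample h is a hypothesis; anchors are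
algebraic split models; Chow at the end). Acknowledged: the bet is exactly that projective
hyperbolic members put a subvariety in the rational door.
- Literature.Barriers.HodgeConjecture.Voisin2002_weilTorus_hodgeClassWithoutSubvarieties: same
answer; Voisin's Weil tori are the non-projective points of the same period domain and the route's
statements quantify over AbelianVariety C (projective) only.
- Literature.Barriers.HodgeConjecture.Kollar1992_nonTorsionClass_notAlgebraic: relevant in spirit:
BoundaryEffective asks for EFFECTIVE representability (up to C^x) of a rational boundary class by
ONE irreducible subvariety, which can fail without contradicting HC (ext

Novelty grade: new-combination — ROUTE REVIEW pointer (refuter g2, 2026-08-15): the full review of this route is g0's (refuter-rreview-…-5ec9aa5a-0) — per-item notes + stamps on 3445–3451 at 13:39–13:42Z (7/7 rc0; Assembly and BoundaryEffective→Fourfold proved as evidence; Weil-datum encoding audited faithful; strong-cone constants (refuter refuter-rreview-route-AtomisticToContinu-5ec9aa5a-g2-0, 2026-08-15T14:06:34Z; prior: DebarreEtAl2011 Lemma 1.5; Demailly1982; HarveyLawson1982; vanGeemen1994HodgeAV 5.2-5.4; Markman2025SecantWeil 1.1; Schoen1988HodgeWeil; BogomolovTschinkel2000 doi:10.4310/a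jm.2000.v4.n1.a3)

History (route lifecycle, newest last):
- 2026-08-15T13:48:18Z · CLOSED retired — not-a-thesis: assembly does not conclude the sub-problem Statement (operator:999:1257524)

sub-problem: HodgeConjecture · status: closed(retired) · opened planner-plancard-HodgeConjecture-HodgeConject-5202819d-0 2026-08-15T11:17:59Z · rev 0 · ledger route-HodgeConjecture-WeilConeBoundary
GENERATED by the gate from the ledger (D-0016/17). Provers cite these decls: `theorem foo : Summit.HodgeConjecture.HodgeConjecture.Theses.WeilConeBoundary.<Decl> := …` in Summits/HodgeConjecture/HodgeConjecture/Theorems/<Name>.lean.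
-/

namespace Summit.HodgeConjecture.HodgeConjecture.Theses.WeilConeBoundary

open scoped BigOperators Topology Manifold Classical MeasureTheory ProbabilityTheory Matrix InnerProductSpace ComplexConjugate ContinuousMap
open Filter Set Function TopologicalSpace MeasureTheory

attribute [summit_statement] _root_.HodgeConjecture

/-- item stmt-HodgeConjecture-3445 · target · rank 0 · closed · moot by None · by planner
why it might fail: True if HC; no independent evidence for n >= 4 (open: Markman 2025 sec. 1.1, arXiv:2603.20268 intro). As typed it covers only rho=1 (B^n = Ce + W) members with a rational K-stable E_h-Lagrangian 2n-frame (= hyperbolic H); generic-to-all-members and non-hyperbolic components are outside the route.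
sources: vanGeemen1994HodgeAV, Markman2025SecantWeil, Schoen1988HodgeWeil, WeilLocusSixfolds2026
[target] WEIL SECTOR TARGET X: for a polarized abelian 2n-fold of Weil type (A, K, iota, h), n >= 2,
Hodge-generic in degree 2n (divisorClassesSpan = C.e with e = h^n up to Q^x, i.e. rho = 1; every
rational (n,n) class in C.e + W; W = sigma^{2n}/sigmabar^{2n} eigenlines of the O_K-action on
H^{2n}, carrying a nonzero rational (n,n) class = Weil type) whose hermitian form is HYPERBOLIC
(typed as: H^1 contains 2n rational, C-independent classes u_i spanning a K-stable subspace,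
pairwise Lagrangian for x.y.f, f a nonzero divisor monomial of degree 2n-1, i.e. f = lambda
h^{2n-1}; equivalently (-1)^n det H in Nm(K^*), a = 1 in vanGeemen1994HodgeAV (5.4.1)), every
rational (n,n) class of W is algebraic. Known: n = 2 all (Markman2025SecantWeil +
Schoen1988HodgeWeil), n = 3 (Schoen Q(sqrt-3); Koike Q(i); Markman all K, disc -1 = hyperbolic);
open for n >= 4. -/
@[route_item "route-HodgeConjecture-WeilConeBoundary"]
def Target : Prop :=
  ∀ (n : ℕ) (A : Literature.AlgebraicGeometry.Motives.AbelianVariety ℂ) (K : Type) [Field K] [NumberField K] (σ : K →+* ℂ) (ι : NumberField.RingOfIntegers K →+* CategoryTheory.End A) (e : Literature.AlgebraicGeometry.HodgeTheory.complexBetti A.X (2 * n)) (W : Submodule ℂ (Literature.AlgebraicGeometry.HodgeTheory.complexBetti A.X (2 * n))), 2 ≤ n → A.dim = 2 * n → Module.finrank ℚ K = 2 → (∃ k : K, σ k ≠ starRingEnd ℂ (σ k)) → Function.Injective ι → e ≠ 0 → Literature.AlgebraicGeometry.HodgeTheory.IsRationalClass e → Literature.Barriers.HodgeConjecture.divisorClassesSpan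 A.X (2 * n) n = ℂ ∙ e → (∀ c : Literature.AlgebraicGeometry.HodgeTheory.complexBetti A.X (2 * n), c ∈ W ↔ ∃ c₁ c₂ : Literature.AlgebraicGeometry.HodgeTheory.complexBetti A.X (2 * n), c = c₁ + c₂ ∧ (∀ k : NumberField.RingOfIntegers K, Literature.AlgebraicGeometry.HodgeTheory.complexBetti.map (ι k).hom.hom.hom (2 * n) c₁ = (σ (k : K)) ^ (2 * n) • c₁) ∧ (∀ k : NumberField.RingOfIntegers K, Literature.AlgebraicGeometry.HodgeTheory.complexBetti.map (ι k).hom.hom.hom (2 * n) c₂ = (starRingEnd ℂ (σ (k : K))) ^ (2 * n) • c₂)) → (∃ w₀ : Literature.AlgebraicGeometry.HodgeTheory.complexBetti A.X (2 * n), w₀ ∈ W ∧ w₀ ≠ 0 ∧ Literature.AlgebraicGeometry.HodgeTheory.IsRationalClass w₀ ∧ Literature.AlgebraicGeometry.HodgeTheory.IsOfHodgeType (2 * n) A.X (2 * n) n n w₀) → (∀ c : Literature.AlgebraicGeometry.HodgeTheory.complexBetti A.X (2 * n), Literature.AlgebraicGeometry.HodgeTheory.IsRationalClass c → Literature.AlgebraicGeometry.HodgeTheory.IsOfHodgeType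 (2 * n) A.X (2 * n) n n c → c ∈ (ℂ ∙ e) ⊔ W) → (∃ (m : ℕ) (f : Literature.AlgebraicGeometry.HodgeTheory.complexBetti A.X (2 * (2 * m + 1))) (u : Fin (2 * n) → Literature.AlgebraicGeometry.HodgeTheory.complexBetti A.X 1), m + 1 = n ∧ f ∈ Literature.Barriers.HodgeConjecture.divisorMonomials A.X (2 * n) (2 * m + 1) ∧ f ≠ 0 ∧ (∀ i, Literature.AlgebraicGeometry.HodgeTheory.IsRationalClass (u i)) ∧ LinearIndependent ℂ u ∧ (∀ k : NumberField.RingOfIntegers K, ∀ i, Literature.AlgebraicGeometry.HodgeTheory.complexBetti.map (ι k).hom.hom.hom 1 (u i) ∈ Submodule.span ℂ (Set.range u)) ∧ (∀ i j, Literature.AlgebraicTopology.SingularHomology.cupProduct (R := ℂ) (show 2 + 2 * (2 * m + 1) = 2 * (2 * m + 2) by ring) (Literature.AlgebraicTopology.SingularHomology.cupProduct (R := ℂ) (rfl : 1 + 1 = 2) (u i) (u j)) f = 0)) → (∀ w : Literature.AlgebraicGeometry.HodgeTheory.complexBetti A.X (2 * n), w ∈ W → Literature.AlgebraicGeometry.HodgeTheory.IsRationalClass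 w → Literature.AlgebraicGeometry.HodgeTheory.IsOfHodgeType (2 * n) A.X (2 * n) n n w → w ∈ Literature.AlgebraicGeometry.HodgeTheory.algebraicClasses A.X n)

/-- item stmt-HodgeConjecture-3446 · crux · rank 2 · closed · moot by None · by planner
why it might fail: DELV 2011 Problem 6.3 suspect Psef^k != Strong^k on general abelian varieties: on a rho=1 Weil 2n-fold the strong-slice boundary ray |c|=2x may carry no irreducible subvariety (rational extremal rays need not be effective; all known Lagrangian/door-type n-folds live in products or Albaneses).
sources: DebarreEtAl2011, arXiv:math/0006135, HarveyLawson1982, Demailly1982, BabaeeHuh2017, vanGeemen1994HodgeAV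
[crux] THE EXISTENCE BET. Same Weil datum, plus a RATIONAL DOOR: a rational class gamma = a e + w (a
in Q, w in W rational (n,n), w != 0) on the boundary of the strong-cone slice, typed by the
homogeneous identity BOUNDARY: for every functional tau on H^{4n}, (-1)^n C(2n,n) tau(w.w) tau(e.e)
= 2 tau(gamma.e)^2 (planner's normalisation: slice = {x omega^n/n! + Re(c w_sigma)}, strong exit |c|
= 2x, <Re cw, Re cw> = (-1)^n |c|^2/2 vol, (omega^n/n!)^2 = C(2n,n) vol; n = 1 check: diagonal of E
x E). CONCLUSION: there is an irreducible Zariski-closed Z in A of codimension >= n and a nonzero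
class c killed by restriction to A - Z (so codim Z = n and c in C^x.cl(Z) by purity) with c = a' e +
w', w' in W, w' != 0, BOUNDARY(c) — i.e. an irreducible n-dimensional subvariety whose class spans a
rational door; by SliceInequality's equality case all its tangent planes are unimodular graphs (V is
an integral variety of Omega_sigma - lambda Omega_sigmabar, |lambda| = 1; n = 2: complex Lagrangian
for a constant holomorphic symplectic form). Evidence: n = 1 classical (rational isotropic nef rays
of abelian surfaces are elliptic curves); split hyperbolic models E^n x E^n carry flat boundary
n-folds ( -/
@[route_item "route-HodgeConjecture-WeilConeBoundary"]
def BoundaryEffective : Prop :=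
  ∀ (n : ℕ) (A : Literature.AlgebraicGeometry.Motives.AbelianVariety ℂ) (K : Type) [Field K] [NumberField K] (σ : K →+* ℂ) (ι : NumberField.RingOfIntegers K →+* CategoryTheory.End A) (e : Literature.AlgebraicGeometry.HodgeTheory.complexBetti A.X (2 * n)) (W : Submodule ℂ (Literature.AlgebraicGeometry.HodgeTheory.complexBetti A.X (2 * n))), 2 ≤ n → A.dim = 2 * n → Module.finrank ℚ K = 2 → (∃ k : K, σ k ≠ starRingEnd ℂ (σ k)) → Function.Injective ι → e ≠ 0 → Literature.AlgebraicGeometry.HodgeTheory.IsRationalClass e → Literature.Barriers.HodgeConjecture.divisorClassesSpan A.X (2 * n) n = ℂ ∙ e → (∀ c : Literature.AlgebraicGeometry.HodgeTheory.complexBetti A.X (2 * n), c ∈ W ↔ ∃ c₁ c₂ : Literature.AlgebraicGeometry.HodgeTheory.complexBetti A.X (2 * n), c = c₁ + c₂ ∧ (∀ k : NumberField.RingOfIntegers K, Literature.AlgebraicGeometry.HodgeTheory.complexBetti.map (ι k).hom.hom.hom (2 * n) c₁ = (σ (k : K)) ^ (2 * n) • c₁) ∧ (∀ k : NumberField.RingOfIntegers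 K, Literature.AlgebraicGeometry.HodgeTheory.complexBetti.map (ι k).hom.hom.hom (2 * n) c₂ = (starRingEnd ℂ (σ (k : K))) ^ (2 * n) • c₂)) → (∃ w₀ : Literature.AlgebraicGeometry.HodgeTheory.complexBetti A.X (2 * n), w₀ ∈ W ∧ w₀ ≠ 0 ∧ Literature.AlgebraicGeometry.HodgeTheory.IsRationalClass w₀ ∧ Literature.AlgebraicGeometry.HodgeTheory.IsOfHodgeType (2 * n) A.X (2 * n) n n w₀) → (∀ c : Literature.AlgebraicGeometry.HodgeTheory.complexBetti A.X (2 * n), Literature.AlgebraicGeometry.HodgeTheory.IsRationalClass c → Literature.AlgebraicGeometry.HodgeTheory.IsOfHodgeType (2 * n) A.X (2 * n) n n c → c ∈ (ℂ ∙ e) ⊔ W) → (∃ (a : ℚ) (w : Literature.AlgebraicGeometry.HodgeTheory.complexBetti A.X (2 * n)), w ∈ W ∧ w ≠ 0 ∧ Literature.AlgebraicGeometry.HodgeTheory.IsRationalClass w ∧ Literature.AlgebraicGeometry.HodgeTheory.IsOfHodgeType (2 * n) A.X (2 * n) n n w ∧ (∀ τ : Literature.AlgebraicGeometry.HodgeTheory.complexBetti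 A.X (2 * (2 * n)) →ₗ[ℂ] ℂ, (-1 : ℂ) ^ n * (Nat.centralBinom n : ℂ) * τ (Literature.AlgebraicTopology.SingularHomology.cupProduct (R := ℂ) (two_mul (2 * n)).symm w w) * τ (Literature.AlgebraicTopology.SingularHomology.cupProduct (R := ℂ) (two_mul (2 * n)).symm e e) = 2 * (τ (Literature.AlgebraicTopology.SingularHomology.cupProduct (R := ℂ) (two_mul (2 * n)).symm ((a : ℂ) • e + w) e)) ^ 2)) → (∃ Z : Set A.X.left, IsClosed Z ∧ IsIrreducible Z ∧ (∀ z ∈ Z, (n : ℕ∞) ≤ Order.coheight z) ∧ ∃ (c : Literature.AlgebraicGeometry.HodgeTheory.complexBetti A.X (2 * n)) (a : ℂ) (w : Literature.AlgebraicGeometry.HodgeTheory.complexBetti A.X (2 * n)), Literature.AlgebraicGeometry.HodgeTheory.complexBetti.restrictCompl A.X Z (2 * n) c = 0 ∧ c ≠ 0 ∧ w ∈ W ∧ w ≠ 0 ∧ c = a • e + w ∧ (∀ τ : Literature.AlgebraicGeometry.HodgeTheory.complexBetti A.X (2 * (2 * n)) →ₗ[ℂ] ℂ, (-1 : ℂ)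 ^ n * (Nat.centralBinom n : ℂ) * τ (Literature.AlgebraicTopology.SingularHomology.cupProduct (R := ℂ) (two_mul (2 * n)).symm w w) * τ (Literature.AlgebraicTopology.SingularHomology.cupProduct (R := ℂ) (two_mul (2 * n)).symm e e) = 2 * (τ (Literature.AlgebraicTopology.SingularHomology.cupProduct (R := ℂ) (two_mul (2 * n)).symm (c) e)) ^ 2))

/-- item stmt-HodgeConjecture-3447 · crux · rank 3 · closed · moot by None · by planner
why it might fail: One universal constant off - the HR sign (-1)^n on W, the factor C(2n,n)/2, Pf(E) vs det(H) (vG 5.4: det H = (-1)^n a), or the class of d^n for odd n - and the iff fails on EVERY member of some component; decidable on E^n x E^n or on Markman's X x X^, where disc H = (-1)^n.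
sources: vanGeemen1994HodgeAV, Markman2025SecantWeil, MoonenZarhin1995Duke, Weil1977HodgeRing
[crux] THE NORM IDENTITY WITH ALL CONSTANTS ('the discriminant is the rationality of the door').
Same Weil datum: (EXISTS rational door: a in Q, w in W rational (n,n) nonzero with BOUNDARY(a e +
w)) <-> (EXISTS m, f, u: m + 1 = n, f a nonzero divisor monomial of degree 2m+1 = 2n-1, u : Fin 2n
-> H^1 rational, C-linearly independent, K-stable span, u_i.u_j.f = 0 for all i j), i.e. <-> the van
Geemen hermitian form is hyperbolic <-> (-1)^n det H in Nm(K^*) <-> a = 1. Derivation (planner,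
NOTES.md): W_Q = {c.v^sigma_{1..2n} + cbar.v^sigmabar_{1..2n}}, V_sigma and V_sigmabar are
E-isotropic (vG 6.10), so (w.w) = 2 Nm(c) (-1)^n det[E(v_i^sigma, v_j^sigmabar)]/Pf(E) with
Pf[[0,M],[-M^t,0]] = (-1)^n det M and det M = sigma(xi)^{2n} det(H_ij) = (-d s^2)^n det H for E =
Tr(xi H); door <-> (-1)^n C(2n,n)(w.w)/(2 h^{2n}) in Q^{x2}.Nm(K^*) = Nm(K^*) <-> (-1)^n d^n det H
in Nm <-> (-1)^n det H in Nm (d = Nm(sqrt -d)); Landherr: signature (n,n) + det class (-1)^n <->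
hyperbolic <-> Witt index n <-> K-stable E-Lagrangian (E-isotropy of a K-stable subspace =
H-isotropy); the pairing x.y.h^{2n-1} on H^1 is Pf(E) times the dual of E (same det class since x =
x^{-1} mod Nm, same Witt index). Orientat -/
@[route_item "route-HodgeConjecture-WeilConeBoundary"]
def DiscriminantDoor : Prop :=
  ∀ (n : ℕ) (A : Literature.AlgebraicGeometry.Motives.AbelianVariety ℂ) (K : Type) [Field K] [NumberField K] (σ : K →+* ℂ) (ι : NumberField.RingOfIntegers K →+* CategoryTheory.End A) (e : Literature.AlgebraicGeometry.HodgeTheory.complexBetti A.X (2 * n)) (W : Submodule ℂ (Literature.AlgebraicGeometry.HodgeTheory.complexBetti A.X (2 * n))), 2 ≤ n → A.dim = 2 * n → Module.finrank ℚ K = 2 → (∃ k : K, σ k ≠ starRingEnd ℂ (σ k)) → Function.Injective ι → e ≠ 0 → Literature.AlgebraicGeometry.HodgeTheory.IsRationalClass e → Literature.Barriers.HodgeConjecture.divisorClassesSpan A.X (2 * n) n = ℂ ∙ e → (∀ c : Literature.AlgebraicGeometry.HodgeTheory.complexBetti A.X (2 * n), c ∈ W ↔ ∃ c₁ c₂ :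 Literature.AlgebraicGeometry.HodgeTheory.complexBetti A.X (2 * n), c = c₁ + c₂ ∧ (∀ k : NumberField.RingOfIntegers K, Literature.AlgebraicGeometry.HodgeTheory.complexBetti.map (ι k).hom.hom.hom (2 * n) c₁ = (σ (k : K)) ^ (2 * n) • c₁) ∧ (∀ k : NumberField.RingOfIntegers K, Literature.AlgebraicGeometry.HodgeTheory.complexBetti.map (ι k).hom.hom.hom (2 * n) c₂ = (starRingEnd ℂ (σ (k : K))) ^ (2 * n) • c₂)) → (∃ w₀ : Literature.AlgebraicGeometry.HodgeTheory.complexBetti A.X (2 * n), w₀ ∈ W ∧ w₀ ≠ 0 ∧ Literature.AlgebraicGeometry.HodgeTheory.IsRationalClass w₀ ∧ Literature.AlgebraicGeometry.HodgeTheory.IsOfHodgeType (2 * n) A.X (2 * n) n n w₀) → (∀ c : Literature.AlgebraicGeometry.HodgeTheory.complexBetti A.X (2 * n), Literature.AlgebraicGeometry.HodgeTheory.IsRationalClass c → Literature.AlgebraicGeometry.HodgeTheory.IsOfHodgeType (2 * n) A.X (2 * n) n n c → c ∈ (ℂ ∙ e) ⊔ W) → ((∃ (a : ℚ) (w : Literature.AlgebraicGeometry.HodgeTheory.complexBetti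 A.X (2 * n)), w ∈ W ∧ w ≠ 0 ∧ Literature.AlgebraicGeometry.HodgeTheory.IsRationalClass w ∧ Literature.AlgebraicGeometry.HodgeTheory.IsOfHodgeType (2 * n) A.X (2 * n) n n w ∧ (∀ τ : Literature.AlgebraicGeometry.HodgeTheory.complexBetti A.X (2 * (2 * n)) →ₗ[ℂ] ℂ, (-1 : ℂ) ^ n * (Nat.centralBinom n : ℂ) * τ (Literature.AlgebraicTopology.SingularHomology.cupProduct (R := ℂ) (two_mul (2 * n)).symm w w) * τ (Literature.AlgebraicTopology.SingularHomology.cupProduct (R := ℂ) (two_mul (2 * n)).symm e e) = 2 * (τ (Literature.AlgebraicTopology.SingularHomology.cupProduct (R := ℂ) (two_mul (2 * n)).symm ((a : ℂ) • e + w) e)) ^ 2)) ↔ (∃ (m : ℕ) (f : Literature.AlgebraicGeometry.HodgeTheory.complexBetti A.X (2 * (2 * m + 1))) (u : Fin (2 * n) → Literature.AlgebraicGeometry.HodgeTheory.complexBetti A.X 1), m + 1 = n ∧ f ∈ Literature.Barriers.HodgeConjecture.divisorMonomials A.X (2 * n) (2 * m + 1) ∧ f ≠ 0 ∧ (∀ i,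 Literature.AlgebraicGeometry.HodgeTheory.IsRationalClass (u i)) ∧ LinearIndependent ℂ u ∧ (∀ k : NumberField.RingOfIntegers K, ∀ i, Literature.AlgebraicGeometry.HodgeTheory.complexBetti.map (ι k).hom.hom.hom 1 (u i) ∈ Submodule.span ℂ (Set.range u)) ∧ (∀ i j, Literature.AlgebraicTopology.SingularHomology.cupProduct (R := ℂ) (show 2 + 2 * (2 * m + 1) = 2 * (2 * m + 2) by ring) (Literature.AlgebraicTopology.SingularHomology.cupProduct (R := ℂ) (rfl : 1 + 1 = 2) (u i) (u j)) f = 0)))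

/-- item stmt-HodgeConjecture-3448 · crux · rank 4 · closed · moot by None · by planner
why it might fail: Known Lagrangian surfaces in abelian 4-folds (Bogomolov-Tschinkel in A1xA2; Schoen/CMLR in Alb(S), BKP Ex. 4.32; BPS-type in AxA/K) are Lagrangian for ONE invariant, maybe mixed-type, 2-form on special fourfolds; a door surface (pure-type form, |lambda|=1, rho=1 hyperbolic fourfold) may not exist.
sources: Schoen1988HodgeWeil, arXiv:2208.09474, arXiv:math/0006135, arXiv:1303.1750, arXiv:2502.13087, vanGeemen2022WeilDecomposable
[crux] CALIBRATION AT n = 2 (the cheapest decisive test, where HC is a theorem): BoundaryEffective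
with n = 2 — a Hodge-generic polarized Weil-type abelian FOURFOLD with hyperbolic H (det H = 1:
Schoen1988HodgeWeil's Q(sqrt-3)/Q(i) families, Markman's generalized-Kummer fourfolds for every K)
carries an irreducible surface S with class on the rational door: 6 (w.w)(e.e) = 2([S].e)^2,
equivalently S is complex Lagrangian for a constant holomorphic symplectic form dz_1 dz_2 - lambda
du_1 du_2 with |lambda| = 1 in polarisation-normalised coordinates and [S] not in Q h^2. Test
material: Schoen's Prym surfaces phi_* S_i (vanGeemen1994HodgeAV 7.2), van Geemen's theta-divisor
intersections, the Lagrangian Schoen surfaces in their Weil-type Albanese (Bae-Kool-Park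
arXiv:2208.09474 Ex. 4.32), vanGeemen2022WeilDecomposable (which classes on J x J deform to Weil
families). A refutation here (all known cycles interior AND an argument that no boundary surface
exists on some hyperbolic generic fourfold) closes the route; a proof anchors the n >= 3 attack. WHY
IT MIGHT FAIL: the Lagrangian structure of Schoen surfaces may be for a Z/3-INVARIANT (mixed-type
V_sigma (x) V_sigmabar) symplectic form, -/
@[route_item "route-HodgeConjecture-WeilConeBoundary"]
def BoundaryEffectiveFourfold : Prop :=
  ∀ (n : ℕ), n = 2 → ∀ (A : Literature.AlgebraicGeometry.Motives.AbelianVariety ℂ) (K : Type) [Field K] [NumberField K] (σ : K →+* ℂ) (ι : NumberField.RingOfIntegers K →+* CategoryTheory.End A) (e : Literature.AlgebraicGeometry.HodgeTheory.complexBetti A.X (2 * n)) (W : Submodule ℂ (Literature.AlgebraicGeometry.HodgeTheory.complexBetti A.X (2 * n))), A.dim = 2 * n → Module.finrank ℚ K = 2 → (∃ k : K, σ k ≠ starRingEnd ℂ (σ k)) → Function.Injective ι → e ≠ 0 → Literature.AlgebraicGeometry.HodgeTheory.IsRationalClass e → Literature.Barriers.HodgeConjecture.divisorClassesSpan A.X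 (2 * n) n = ℂ ∙ e → (∀ c : Literature.AlgebraicGeometry.HodgeTheory.complexBetti A.X (2 * n), c ∈ W ↔ ∃ c₁ c₂ : Literature.AlgebraicGeometry.HodgeTheory.complexBetti A.X (2 * n), c = c₁ + c₂ ∧ (∀ k : NumberField.RingOfIntegers K, Literature.AlgebraicGeometry.HodgeTheory.complexBetti.map (ι k).hom.hom.hom (2 * n) c₁ = (σ (k : K)) ^ (2 * n) • c₁) ∧ (∀ k : NumberField.RingOfIntegers K, Literature.AlgebraicGeometry.HodgeTheory.complexBetti.map (ι k).hom.hom.hom (2 * n) c₂ = (starRingEnd ℂ (σ (k : K))) ^ (2 * n) • c₂)) → (∃ w₀ : Literature.AlgebraicGeometry.HodgeTheory.complexBetti A.X (2 * n), w₀ ∈ W ∧ w₀ ≠ 0 ∧ Literature.AlgebraicGeometry.HodgeTheory.IsRationalClass w₀ ∧ Literature.AlgebraicGeometry.HodgeTheory.IsOfHodgeType (2 * n) A.X (2 * n) n n w₀) → (∀ c : Literature.AlgebraicGeometry.HodgeTheory.complexBetti A.X (2 * n), Literature.AlgebraicGeometry.HodgeTheory.IsRationalClass c → Literature.AlgebraicGeometry.HodgeTheory.IsOfHodgeType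 (2 * n) A.X (2 * n) n n c → c ∈ (ℂ ∙ e) ⊔ W) → (∃ (a : ℚ) (w : Literature.AlgebraicGeometry.HodgeTheory.complexBetti A.X (2 * n)), w ∈ W ∧ w ≠ 0 ∧ Literature.AlgebraicGeometry.HodgeTheory.IsRationalClass w ∧ Literature.AlgebraicGeometry.HodgeTheory.IsOfHodgeType (2 * n) A.X (2 * n) n n w ∧ (∀ τ : Literature.AlgebraicGeometry.HodgeTheory.complexBetti A.X (2 * (2 * n)) →ₗ[ℂ] ℂ, (-1 : ℂ) ^ n * (Nat.centralBinom n : ℂ) * τ (Literature.AlgebraicTopology.SingularHomology.cupProduct (R := ℂ) (two_mul (2 * n)).symm w w) * τ (Literature.AlgebraicTopology.SingularHomology.cupProduct (R := ℂ) (two_mul (2 * n)).symm e e) = 2 * (τ (Literature.AlgebraicTopology.SingularHomology.cupProduct (R := ℂ) (two_mul (2 * n)).symm ((a : ℂ) • e + w) e)) ^ 2)) → (∃ Z : Set A.X.left, IsClosed Z ∧ IsIrreducible Z ∧ (∀ z ∈ Z, (n : ℕ∞) ≤ Order.coheight z) ∧ ∃ (c : Literature.AlgebraicGeometry.HodgeTheory.complexBetti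 A.X (2 * n)) (a : ℂ) (w : Literature.AlgebraicGeometry.HodgeTheory.complexBetti A.X (2 * n)), Literature.AlgebraicGeometry.HodgeTheory.complexBetti.restrictCompl A.X Z (2 * n) c = 0 ∧ c ≠ 0 ∧ w ∈ W ∧ w ≠ 0 ∧ c = a • e + w ∧ (∀ τ : Literature.AlgebraicGeometry.HodgeTheory.complexBetti A.X (2 * (2 * n)) →ₗ[ℂ] ℂ, (-1 : ℂ) ^ n * (Nat.centralBinom n : ℂ) * τ (Literature.AlgebraicTopology.SingularHomology.cupProduct (R := ℂ) (two_mul (2 * n)).symm w w) * τ (Literature.AlgebraicTopology.SingularHomology.cupProduct (R := ℂ) (two_mul (2 * n)).symm e e) = 2 * (τ (Literature.AlgebraicTopology.SingularHomology.cupProduct (R := ℂ) (two_mul (2 * n)).symm (c) e)) ^ 2))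

/-- item stmt-HodgeConjecture-3449 · support · rank 9 · closed · moot by None · by planner
sources: DebarreEtAl2011, Demailly1982, HarveyLawson1982
[support] STRONG-CONE INEQUALITY FOR SUBVARIETIES (theorem in principle; infrastructure-heavy). Same
Weil datum; for every irreducible closed Z of codimension >= n and every class c killed off Z with c
= a e + w, w in W, and every functional tau with tau(c.e) != 0: (-1)^n C(2n,n) tau(w.w) tau(e.e) = 2
t tau(c.e)^2 for some real t in [0,1]. Proof sketch: cl(Z) is the class of a strongly positive
closed current, its translation average is a strongly positive constant (n,n)-form in the G_1 =
S(U(n) x U(n))-invariant slice (DebarreEtAl2011 Lemma 1.5: Psef^k in Strong^k); pairing with the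
weakly positive witness sigma_theta = (omega_z^n + omega_u^n)/(2 n!) - Re(e^{-i theta} w_sigma)
(weak positivity = AM-GM (|det Z|^2 + |det U|^2)/2 >= |det Z det U| on unitary n-frames) gives |c|
<= 2x, i.e. t <= 1; t >= 0 is Hodge-Riemann on W (sign (-1)^n). Prover lemmas foreseen (--supports):
weak exit |det Z||det U| <= 2^{-n} when Z*Z + U*U = 1 (Mathlib-typable); s0 = 2 attained by
moment-matching measures on {prod p_i = prod(1 - p_i)}; translation averaging of positive currents
on complex tori. Sources: DebarreEtAl2011 Lemma 1.5 and sec. 1; Demailly1982; HarveyLawson1982 II. -/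
@[route_item "route-HodgeConjecture-WeilConeBoundary"]
def SliceInequality : Prop :=
  ∀ (n : ℕ) (A : Literature.AlgebraicGeometry.Motives.AbelianVariety ℂ) (K : Type) [Field K] [NumberField K] (σ : K →+* ℂ) (ι : NumberField.RingOfIntegers K →+* CategoryTheory.End A) (e : Literature.AlgebraicGeometry.HodgeTheory.complexBetti A.X (2 * n)) (W : Submodule ℂ (Literature.AlgebraicGeometry.HodgeTheory.complexBetti A.X (2 * n))), 2 ≤ n → A.dim = 2 * n → Module.finrank ℚ K = 2 → (∃ k : K, σ k ≠ starRingEnd ℂ (σ k)) → Function.Injective ι → e ≠ 0 → Literature.AlgebraicGeometry.HodgeTheory.IsRationalClass e → Literature.Barriers.HodgeConjecture.divisorClassesSpan A.X (2 * n) n = ℂ ∙ e → (∀ c : Literature.AlgebraicGeometry.HodgeTheory.complexBetti A.X (2 * n), c ∈ W ↔ ∃ c₁ c₂ : Literature.AlgebraicGeometry.HodgeTheory.complexBetti A.X (2 * n), c = c₁ + c₂ ∧ (∀ k : NumberField.RingOfIntegers K, Literature.AlgebraicGeometry.HodgeTheory.complexBetti.map (ι k).hom.hom.hom (2 * n) c₁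 = (σ (k : K)) ^ (2 * n) • c₁) ∧ (∀ k : NumberField.RingOfIntegers K, Literature.AlgebraicGeometry.HodgeTheory.complexBetti.map (ι k).hom.hom.hom (2 * n) c₂ = (starRingEnd ℂ (σ (k : K))) ^ (2 * n) • c₂)) → (∃ w₀ : Literature.AlgebraicGeometry.HodgeTheory.complexBetti A.X (2 * n), w₀ ∈ W ∧ w₀ ≠ 0 ∧ Literature.AlgebraicGeometry.HodgeTheory.IsRationalClass w₀ ∧ Literature.AlgebraicGeometry.HodgeTheory.IsOfHodgeType (2 * n) A.X (2 * n) n n w₀) → (∀ c : Literature.AlgebraicGeometry.HodgeTheory.complexBetti A.X (2 * n), Literature.AlgebraicGeometry.HodgeTheory.IsRationalClass c → Literature.AlgebraicGeometry.HodgeTheory.IsOfHodgeType (2 * n) A.X (2 * n) n n c → c ∈ (ℂ ∙ e) ⊔ W) → ∀ Z : Set A.X.left, IsClosed Z → IsIrreducible Z → (∀ z ∈ Z, (n : ℕ∞) ≤ Order.coheight z) → ∀ (c : Literature.AlgebraicGeometry.HodgeTheory.complexBetti A.X (2 * n)) (a : ℂ) (w : Literature.AlgebraicGeometry.HodgeTheory.complexBetti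 A.X (2 * n)), Literature.AlgebraicGeometry.HodgeTheory.complexBetti.restrictCompl A.X Z (2 * n) c = 0 → w ∈ W → c = a • e + w → ∀ τ : Literature.AlgebraicGeometry.HodgeTheory.complexBetti A.X (2 * (2 * n)) →ₗ[ℂ] ℂ, τ (Literature.AlgebraicTopology.SingularHomology.cupProduct (R := ℂ) (two_mul (2 * n)).symm c e) ≠ 0 → ∃ t : ℝ, 0 ≤ t ∧ t ≤ 1 ∧ (-1 : ℂ) ^ n * (Nat.centralBinom n : ℂ) * τ (Literature.AlgebraicTopology.SingularHomology.cupProduct (R := ℂ) (two_mul (2 * n)).symm w w) * τ (Literature.AlgebraicTopology.SingularHomology.cupProduct (R := ℂ) (two_mul (2 * n)).symm e e) = 2 * (t : ℂ) * (τ (Literature.AlgebraicTopology.SingularHomology.cupProduct (R := ℂ) (two_mul (2 * n)).symm c e)) ^ 2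

/-- item stmt-HodgeConjecture-3450 · support · rank 9 · closed · moot by None · by planner
sources: vanGeemen1994HodgeAV
[support] FROM ONE DOOR CYCLE TO ALL WEIL CLASSES. Same Weil datum; if some irreducible Z and
nonzero c killed off Z have c = a e + w with w in W, w != 0 (conclusion of BoundaryEffective;
BOUNDARY itself is not needed), then every rational (n,n) class of W is algebraic. Proof sketch: c
in algebraicClasses A.X n by definition (supported in codimension n); e in algebraicClasses (e =
lambda h^n, h ample: complete intersections; on the tree this needs cup products of divisor classes
algebraic, cf. HodgeTheory/AlgebraicClassesCup); so w algebraic; pull-backs (iota k)^* preserve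
algebraicClasses (item QbarEnvelope.PullbackAlgebraic, Fulton 19.2) and act on W through the two
characters sigma^{2n} != sigmabar^{2n}, so the O_K-translates of w = c_sigma + c_sigmabar (both
components nonzero for a real class) span W over C. Sources: vanGeemen1994HodgeAV 2.4, 5.2; Fulton
19.1-19.2 via QbarEnvelope.PullbackAlgebraic. -/
@[route_item "route-HodgeConjecture-WeilConeBoundary"]
def WeilAlgebraicOfBoundary : Prop :=
  ∀ (n : ℕ) (A : Literature.AlgebraicGeometry.Motives.AbelianVariety ℂ) (K : Type) [Field K] [NumberField K] (σ : K →+* ℂ) (ι : NumberField.RingOfIntegers K →+* CategoryTheory.End A) (e : Literature.AlgebraicGeometry.HodgeTheory.complexBetti A.X (2 * n)) (W : Submodule ℂ (Literature.AlgebraicGeometry.HodgeTheory.complexBetti A.X (2 * n))), 2 ≤ n → A.dim = 2 * n → Module.finrank ℚ K = 2 → (∃ k : K, σ k ≠ starRingEnd ℂ (σ k)) → Function.Injective ι → e ≠ 0 → Literature.AlgebraicGeometry.HodgeTheory.IsRationalClass e → Literature.Barriers.HodgeConjecture.divisorClassesSpan A.X (2 * n) n = ℂ ∙ e → (∀ c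 : Literature.AlgebraicGeometry.HodgeTheory.complexBetti A.X (2 * n), c ∈ W ↔ ∃ c₁ c₂ : Literature.AlgebraicGeometry.HodgeTheory.complexBetti A.X (2 * n), c = c₁ + c₂ ∧ (∀ k : NumberField.RingOfIntegers K, Literature.AlgebraicGeometry.HodgeTheory.complexBetti.map (ι k).hom.hom.hom (2 * n) c₁ = (σ (k : K)) ^ (2 * n) • c₁) ∧ (∀ k : NumberField.RingOfIntegers K, Literature.AlgebraicGeometry.HodgeTheory.complexBetti.map (ι k).hom.hom.hom (2 * n) c₂ = (starRingEnd ℂ (σ (k : K))) ^ (2 * n) • c₂)) → (∃ w₀ : Literature.AlgebraicGeometry.HodgeTheory.complexBetti A.X (2 * n), w₀ ∈ W ∧ w₀ ≠ 0 ∧ Literature.AlgebraicGeometry.HodgeTheory.IsRationalClass w₀ ∧ Literature.AlgebraicGeometry.HodgeTheory.IsOfHodgeType (2 * n) A.X (2 * n) n n w₀) → (∀ c : Literature.AlgebraicGeometry.HodgeTheory.complexBetti A.X (2 * n), Literature.AlgebraicGeometry.HodgeTheory.IsRationalClass c → Literature.AlgebraicGeometry.HodgeTheory.IsOfHodgeType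 (2 * n) A.X (2 * n) n n c → c ∈ (ℂ ∙ e) ⊔ W) → (∃ Z : Set A.X.left, IsClosed Z ∧ IsIrreducible Z ∧ (∀ z ∈ Z, (n : ℕ∞) ≤ Order.coheight z) ∧ ∃ (c : Literature.AlgebraicGeometry.HodgeTheory.complexBetti A.X (2 * n)) (a : ℂ) (w : Literature.AlgebraicGeometry.HodgeTheory.complexBetti A.X (2 * n)), Literature.AlgebraicGeometry.HodgeTheory.complexBetti.restrictCompl A.X Z (2 * n) c = 0 ∧ c ≠ 0 ∧ w ∈ W ∧ w ≠ 0 ∧ c = a • e + w ∧ (∀ τ : Literature.AlgebraicGeometry.HodgeTheory.complexBetti A.X (2 * (2 * n)) →ₗ[ℂ] ℂ, (-1 : ℂ) ^ n * (Nat.centralBinom n : ℂ) * τ (Literature.AlgebraicTopology.SingularHomology.cupProduct (R := ℂ) (two_mul (2 * n)).symm w w) * τ (Literature.AlgebraicTopology.SingularHomology.cupProduct (R := ℂ) (two_mul (2 * n)).symm e e) = 2 * (τ (Literature.AlgebraicTopology.SingularHomology.cupProduct (R := ℂ) (two_mul (2 * n)).symm (c) e)) ^ 2)) → (∀ w : Literature.AlgebraicGeometry.HodgeTheory.complexBetti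 A.X (2 * n), w ∈ W → Literature.AlgebraicGeometry.HodgeTheory.IsRationalClass w → Literature.AlgebraicGeometry.HodgeTheory.IsOfHodgeType (2 * n) A.X (2 * n) n n w → w ∈ Literature.AlgebraicGeometry.HodgeTheory.algebraicClasses A.X n)

/-- item stmt-HodgeConjecture-3451 · assembly · rank 1 · closed · moot by None · by planner
[assembly] BoundaryEffective -> WeilAlgebraicOfBoundary -> DiscriminantDoor -> Target: given
Target's hypotheses (Weil datum + K-stable rational Lagrangian 2n-frame), DiscriminantDoor (<-)
produces the rational door, BoundaryEffective the irreducible Z with boundary class c = a e + w, w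
!= 0, and WeilAlgebraicOfBoundary the algebraicity of W. Pure logic over syntactically identical
binder blocks. DELIBERATELY NOT '-> _root_.HodgeConjecture': this is the Weil-sector (hyperbolic
components, Hodge-generic members) partial route recorded as such; SliceInequality and
BoundaryEffectiveFourfold are the design justification and the first test, not links of the chain. -/
@[route_item "route-HodgeConjecture-WeilConeBoundary"]
def Assembly : Prop :=
  BoundaryEffective → WeilAlgebraicOfBoundary → DiscriminantDoor → Target

end Summit.HodgeConjecture.HodgeConjecture.Theses.WeilConeBoundary
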